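import Literature.MathematicalPhysics.QuantumFieldTheory.Balaban1983to89.Node00.Record13SepCoPInhabitedOfThm1CCMWGaugeRAllTorus
import Literature.MathematicalPhysics.QuantumFieldTheory.Balaban1983to89.Node00.Record12BgRowCoClassGaugeRGuardedBRow

/-!
# DAG node N11 × K1 — ROW P11 `bg` ON B′'s GaugeR ROAD WITHOUT THE RUN GUARD: the body reads the torus only through K0b's (1.12)-cube inclusion `hcubeΩ` and the no-wrap letter `hsN`;
# with `hcubeΩ` a HYPOTHESIS the antecedent `PartCompat₁₃` disappears from the Stage-13 reduction and from the witness theorem at `θ₁₅ᶜᶜᴹᵂ(j; γ)` on every non-wrapping family (`j + 1 ≤ F.m`)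

METADATA.  Cell `pub-ymgap`, Track A (D-0062 ∕ D-0149 ∕ D-0154), seat `pub-ymgap-dag-n11-w5` (g2; v1, plan g85 WORD-2 «BG-ONEBLOCK», bus l.34912 ∕ l.35246 ∕ l.35303), route `BalabanUVNodes`,
item K1⁸ = stmt-QuantumFields-26907 (helper lane, count-neutral); EDITION v1.1 by `pub-ymgap-dag-n11-d` g41 (Stage-2 train, WORKPLAN-IIIB (iii-b), director-ym №343 (D5)∕(D6), №347; row
TRAIN-N11 T2-(7)(a), for the assigned pen dag-n11-w1; key `--supports stmt-QuantumFields-20541 --as helper`).  [III] = [Balaban1988Convergent], [I] = [Balaban1987RG1], [15] =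
[Balaban1985Variational], [6] = [Balaban1985RegularSpaces], [II] = [Balaban1984PropagatorsII].  Over B′ (dag-n21-c ∕ node00-def-K0a): `Node00/Record12BgRowCoClassGauge` (:291,
`localGauge_cubesI_of_localGaugeOn`, `condII238_cubesMS_of_localGaugeOn`), `…CoClass`, `…CoClassGaugeR` (:132 ∕ :238 ∕ :303), `…InhabitedOfThm1CCMWGaugeRSignFree` (Eʷ),
`Record13LettersOfThm1CCMW`, K0b's `…CubeGeometry` (`hcubeΩ_of_compatible` :217); v1.1 also over S1a-C `Record12BgRowCoClassCPMFloorB`, S1b-2 `…GaugeRGuardedB` and k0-s1-w1's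
`…GaugeRGuardedBRow` ✓p766227 (`ubgMSCoPOfRecord_dichotomy_genSetDatum`).  v1's full provenance header: git history of this file (p-lineage of dag-n11-w5 g2).

WHY.  On B′'s road the compatibility (C2) is consumed at EXACTLY ONE place — K0b's `hcubeΩ_of_compatible` («every (1.12) `L^{j+1}M`-cube meeting a domain `X ⊆ Λ_j(s)` lies in `Ω_j(s)`»);
taking `hcubeΩ` as a HYPOTHESIS removes `PartCompat₁₃` from the Stage-13 reduction (§4) and from the witness theorems (§5∕§6); `hcube` is discharged at every power-of-`L` basic cube by
dag-n11-w4's `hcubeΩ_of_powM` from (C1) alone; the wrapping families `F.m ≤ j` are not served (`not_hsN_theta13OfThm1CCMW_of_le`).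
WHAT (0 `sorry`, 0 `def`; hypothesis threading; nothing of Bałaban asserted).  §1 ★★ `bgRowAtDatumU_of_classBoundsPos_of_localGauge_of_hcubeΩ` · §2 ★★
`bgRowAtDatumU_of_thm1RegSepTop7M_of_thm1GaugeR_of_hcubeΩ` · §3 ★★ `bgRowAtDatumCoP_of_thm1RegSepCoP7M_of_thm1GaugeR_of_hcubeΩ` · §4 ★★ `stage13_bgAtDatumCoP_of_thm1RegSepCoP7M_of_thm1GaugeR_of_hcubeΩ`
(NO `PartCompat₁₃`) · §5 ★★★ `bgSepCoPAt_theta13OfThm1CCMW_of_thm1GaugeR_of_hcomp_of_hjm_of_hcubeΩ` · §6 ★★★ `bgProvisoΛ_theta13OfThm1CCMW_of_thm1GaugeR_of_hcomp_of_hjm_of_hcubeΩ` · v1.1 §7 ★★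
`bgRowAtDatumU_of_thm1RegSepTop7MGB_of_thm1GaugeGB_of_hcubeΩ` ∕ ★★ `stage13_bgAtDatumBg_of_thm1RegSepCoP7MGB_of_thm1GaugeGB_of_hcubeΩ` = §2∕§4 over S1a-C∕S1b-2's guarded `(Adm, bd, Dat)`-parametrised
[15] sentences with a GENERIC background entering through its displayed `bd`-spec dichotomy (k0-s1-w1's pattern); every v1 declaration UNTOUCHED; after the `Record13CoP` seam edit the
in-place re-keys of §5∕§6 (and of the `GaugeG` ∕ `Sockets` ∕ `RAtCRLetteredMember` siblings, which import this file) are ONE instantiation of §7.3 at `bd := lamDatum F`,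
`Ubg := UbgOfRecord₁₃CoP` (`UbgOfRecord₁₃CoP_succ` ↦ `UbgMSCoPOfRecordB`), `hbg := ubgMSCoPOfRecordB_dichotomy` (node00-def-R S2b) (FLAG №16 ∕ LOCATE-HSEAM 5d3298b8d191f169).

HONEST FRAMING.  Helper lane (K1⁸ ∕ K0⁷); count-neutral hypothesis threading over landed theorems; NOT a discharge; CONDITIONAL on the [15] letters (8) `VariationalThm1RegSep{Top,CoP}7M[GB]`
and the gauge sentences (9) `VariationalThm1GaugeRegSep{Top,CoP}7M{R,GB}` (Props with parameters, inhabited nowhere), on (hcomp) ∧ (hcompRev), the window `0 < γ ≤ ½`, `hjm : j + 1 ≤ F.m`,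
and the cube inclusion `hcube` — all DISPLAYED, never asserted.  `Provisos₁₃SepCoPH.bg`'s TYPE is untouched.  N11 ∕ N07 NOT discharged; K0⁷ ∕ K1⁸ NOT closed; counts unmoved
(typed 28∕28 · discharged 8∕27).  One finite 𝕋⁴ programme at fixed `ε = L^{−K}` — NOT ℝ⁴, NOT OS, NOT a mass gap, NOT Clay.  No `sorry`, `axiom`, `def`, `instance`, `notation`.
Sources (SHAPE only): [III] (2.1) p.254, (2.4)–(2.8) pp.255–256, (2.12)–(2.13) pp.256–257, (2.18) p.257, (2.25)–(2.28) pp.258–259, (2.34)–(2.41) p.261, Thm 1 p.262, p.257; [I] (0.1) p.251,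
Thm 1 p.259, (1.11)–(1.16) p.262; [15] (6)–(7) p.278, Thm 1 (8)–(9) p.279, (144)–(152) pp.300–301, Prop. 8 p.304; [6] (1.3)–(1.9) p.77; [II] (2.3) p.224.
-/

noncomputable section

open MeasureTheory
open scoped Matrix.Norms.L2Operator

namespace Summit.QuantumFields.YangMills.Theorems.BalabanUVNodesN11BgRowGaugeROfHcubeOmega

open Literature.MathematicalPhysics.QuantumFieldTheory.Balaban1983to89 Node00
open T4Continuum B14.Eq218Concrete B15DeterminingSets B15DeterminingSetsB FlowStep FlowStepRuns B12RegularSpaces111 B14RegularSpaces234 B14Radii T4AxialGaugeSmallField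

variable {F : T4Family} {N : ℕ} [NeZero N]

/-! ## §1–§3  B′'s row body with `hcubeΩ` as a hypothesis -/
section RowBody
/-- **§1 ★★ ROW P11's BODY FOR AN ARBITRARY BACKGROUND `U` FROM PER-SCALE CLASS BOUNDS AND HANDED-OVER LOCAL GAUGES — THE (1.12)-CUBE INCLUSION `hcubeΩ` AS A
HYPOTHESIS** (B′'s `Record12BgRowCoClassGauge.bgRowAtDatumU_of_classBoundsPos_of_localGauge` :291 VERBATIM, the letters (C1)∕(C2) REPLACED by their one use, K0b's conclusion
`hcubeΩ` «every `L^{j+1}M`-cube of record meeting a domain `X ⊆ Λ_j(s)` lies in `Ω_j(s)`»; proof body byte-identical except the one `have hcubeΩ` line).  So the analytic body of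
row P11 reads the torus ONLY through `hcubeΩ` (and, upstream, the no-wrap letter `hsN`); B′'s `hM : 0 < M` binder is DROPPED (its only use was the replaced geometry).
[cite: Balaban1988Convergent, (2.27)–(2.28) p.259, (2.34)–(2.41) p.261; Balaban1987RG1, (1.11)–(1.16) p.262; Balaban1985Variational, Thm 1 (9) p.279] -/
theorem bgRowAtDatumU_of_classBoundsPos_of_localGauge_of_hcubeΩ (S : Sect2.Setting (MatA N) (SU N)) (hι : S.ι = ιSU N) (h𝓜 : S.𝓜 = B12RegularSpaces111SpecialUnitary.suModel N)
    (hS : S.Laws) (hpos : S.Pos) (ν : Stage7Numerics) {M : ℕ} (K k : ℕ) {b t : ℕ → ℝ}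
    (s : SeqOfRecord F ν M S.flow.g K k) (U : GaugeField (F.P K) 0 (SU N))
    (hcube : ∀ j, 1 ≤ j → j ≤ k → ∀ X : (Sect2.domSys (F.P K) M j).Dom, Sect2.domSites (F.P K) M j X ⊆ s.Λ j →
      ∀ a ∈ cubeIndices (F.P K) (B14.Eq213MaximalDomains.side (F.P K).L M (j + 1)),
        (cubeEnl (F.P K) (B14.Eq213MaximalDomains.side (F.P K).L M (j + 1)) a 0 ∩ Sect2.domSites (F.P K) M j X).Nonempty →
        cubeEnl (F.P K) (B14.Eq213MaximalDomains.side (F.P K).L M (j + 1)) a 0 ⊆ s.Ω j)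
    (hclass : ∀ n, 1 ≤ n → n ≤ k → PlaqSmallOn (omegaPlaqs s.Ω n) (b n * (F.P K).eta n ^ 2) (U))
    (hα : ∀ n, 1 ≤ n → n ≤ k → 0 < S.lf.alpha0 (S.flow.g n) ∧ 0 < S.lf.alpha1 (S.flow.g n))
    (hbα : ∀ n, 1 ≤ n → n ≤ k → b n ≤ (1 - S.βc) * S.lf.alpha0 (S.flow.g n))
    (htI : ∀ n, 1 ≤ n → n ≤ k → t n ≤ S.cB * S.lf.alpha0 (S.flow.g n))
    (htMS : ∀ n, 1 ≤ n → n ≤ k → t n ≤ S.B * S.C * S.Mr * S.lf.alpha0 (S.flow.g n))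
    (hgMS : ∀ n, 1 ≤ n → n ≤ k → ∀ a ∈ cubeIndices (F.P K) (B14.Eq213MaximalDomains.side (F.P K).L M n),
      cubeEnl (F.P K) (B14.Eq213MaximalDomains.side (F.P K).L M n) a 0 ⊆ s.Ω n →
      Sect2.LocalGaugeOn (cubeEnl (F.P K) (B14.Eq213MaximalDomains.side (F.P K).L M n) a 0) ((F.P K).eta n) (t n) U)
    (hgI : ∀ n, 1 ≤ n → n ≤ k → ∀ a ∈ cubeIndices (F.P K) (B14.Eq213MaximalDomains.side (F.P K).L M (n + 1)),
      cubeEnl (F.P K) (B14.Eq213MaximalDomains.side (F.P K).L M (n + 1)) a 0 ⊆ s.Ω n →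
      Sect2.LocalGaugeOn (cubeEnl (F.P K) (B14.Eq213MaximalDomains.side (F.P K).L M (n + 1)) a 0) ((F.P K).eta n) (t n) U) :
    ∀ j, 1 ≤ j → j ≤ k → ∀ X : (Sect2.domSys (F.P K) M j).Dom,
      (Sect2.domSites (F.P K) M j X ⊆ s.Λ j →
        Sect2.ofBackgroundC S.ι (U) ∈
          Sect2.spaceI S (Sect2.Residual.unit (F.P K) (MatA N)) M j (Sect2.domSites (F.P K) M j X) (S.lf.alpha0 (S.flow.g j)) (S.lf.alpha1 (S.flow.g j))) ∧
      (Sect2.admB (F.P K) ν M S.flow.g s.Ω s.Λ j (Sect2.domSites (F.P K) M j X) = true →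
        Sect2.ofBackgroundC S.ι (U) ∈
          Sect2.spaceMS S (Sect2.Residual.unit (F.P K) (MatA N)) M j (Sect2.domSites (F.P K) M j X) s.Ω) := by
  intro j h1 hjk X
  have hbα' : ∀ n, 1 ≤ n → n ≤ k → b n ≤ S.lf.alpha0 (S.flow.g n) := by
    intro n hn1 hnk
    refine (hbα n hn1 hnk).trans ?_
    have h0 := (hα n hn1 hnk).1.le
    nlinarith [hpos.βc_nonneg, h0]
  refine ⟨fun hX => ?_, fun _ => ?_⟩
  · -- the `U^c_j` conjunct: class bound at scale `j` for (1.11), the handed-over gauges on the (1.12) cubes (in `Ω_j` by compatibility)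
    have hcubeΩ := hcube j h1 hjk X hX
    have hloc : ∀ C ∈ Sect2.cubesI M j (Sect2.domSites (F.P K) M j X), ∃ u : Site (F.P K) 0 → (MatA N)ˣ, (∀ x, u x ∈ S.𝓜.G) ∧ ∃ A : PBond (F.P K) 0 → MatA N,
          (∀ bd ∈ C.bonds, gaugeU u (fun b' => S.ι (U b')) bd = expI ((F.P K).eta j) (A bd)) ∧
          (∀ bd ∈ C.bonds, ‖A bd‖ < S.cB * S.lf.alpha0 (S.flow.g j)) ∧
          ∀ q ∈ C.dpairs, ‖grad ((F.P K).eta j) q.2.1 (fun y => A ⟨y, q.2.2⟩) q.1‖ < S.cB * S.lf.alpha0 (S.flow.g j) := by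
      simp only [hι, h𝓜]
      exact localGauge_cubesI_of_localGaugeOn hcubeΩ (htI j h1 hjk) (hgI j h1 hjk)
    exact ofBackgroundC_mem_spaceI_of_classBoundU S hι hS ν M S.flow.g K k s U h1 hjk (hα j h1 hjk).1 (hα j h1 hjk).2 X hX
      (hbα' j h1 hjk) (hclass j h1 hjk) hloc
  · -- the `Ũ^c_j` conjunct: class bounds at the scales `1 ≤ n ≤ j` for (2.34), the handed-over gauges on the (2.38) cubes, rescaled to `ξ = η_j`
    have h238 : CondII238 S.𝓜 (Sect2.frameMS (Sect2.Residual.unit (F.P K) (MatA N)) M j (Sect2.domSites (F.P K) M j X) s.Ω)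
          (MSConsts.ofParams (F.P K) S.βc S.B S.C S.Mr j) (fun n => S.lf.alpha0 (S.flow.g n)) (fun b' => S.ι (U b')) := by
      simp only [hι, h𝓜]
      refine condII238_cubesMS_of_localGaugeOn (fun n hn1 hnj => ?_) (fun n hn1 hnj a ha _ hΩ => hgMS n hn1 (hnj.trans hjk) a ha hΩ)
      unfold rad238
      exact htMS n hn1 (hnj.trans hjk)
    exact ofBackgroundC_mem_spaceMS_of_classBoundU S hι hS hpos ν M K k s U (fun n hn1 hnj => hα n hn1 (hnj.trans hjk)) X
      (fun n hn1 hnj => hbα n hn1 (hnj.trans hjk)) (fun n hn1 hnj => hclass n hn1 (hnj.trans hjk)) h238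

/-- **§2 ★★ ROW P11's BODY FOR EVERY MINIMISER `U₀` OVER THE TOP-DOMAIN CLASS (6), FROM (8) `VariationalThm1RegSepTop7M` AND THE R GAUGE SENTENCE — `hcubeΩ` AS A HYPOTHESIS**
(B′'s `Record12BgRowCoClassGaugeR.bgRowAtDatumU_of_thm1RegSepTop7M_of_thm1GaugeR` :132 VERBATIM with (C1)∕(C2) ↦ `hcube`; the no-wrap letter `hsN` kept as B′ states it).
[cite: Balaban1985Variational, Thm 1 (2),(6)–(9) pp.278–279; Balaban1985RegularSpaces, (1.3)–(1.9) p.77; Balaban1988Convergent, (2.4)–(2.8) pp.255–256, (2.12)–(2.13) p.256, (2.27)–(2.28) p.259, (2.34)–(2.41) p.261; Balaban1987RG1, (1.11)–(1.16) p.262] -/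
theorem bgRowAtDatumU_of_thm1RegSepTop7M_of_thm1GaugeR_of_hcubeΩ {Sup : (ν : Stage7Numerics) → (K : ℕ) → (ℕ → Set (Site (F.P K) 0)) → Set (Site (F.P K) 0)} {M c : ℕ}
    {B₃ B₃' a₀ a₁ : ℝ} (h15 : VariationalThm1RegSepTop7M F N Sup B₃ a₀ a₁) (h15G : VariationalThm1GaugeRegSepTop7MR F N Sup M c B₃ B₃' a₀ a₁)
    (S : Sect2.Setting (MatA N) (SU N)) (hι : S.ι = ιSU N) (h𝓜 : S.𝓜 = B12RegularSpaces111SpecialUnitary.suModel N) (hS : S.Laws) (hpos : S.Pos)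
    (ν : Stage7Numerics) (K k : ℕ) (cR : ℝ)
    (hnum : ∀ n, n ≤ k → 0 < cR * epsOfRecord ν S.flow.g n ∧ cR * epsOfRecord ν S.flow.g n ≤ a₁ ∧ B₃ * (cR * epsOfRecord ν S.flow.g n) ≤ ν.εreg)
    (ha₀ : ν.εreg ≤ a₀) (hcomp : ∀ n, n < k → cR * epsOfRecord ν S.flow.g n ≤ 2 * (cR * epsOfRecord ν S.flow.g (n + 1)))
    (hcomp' : ∀ n, n < k → cR * epsOfRecord ν S.flow.g (n + 1) ≤ 2 * (cR * epsOfRecord ν S.flow.g n))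
    (hα : ∀ n, 1 ≤ n → n ≤ k → 0 < S.lf.alpha0 (S.flow.g n) ∧ 0 < S.lf.alpha1 (S.flow.g n))
    (hBα : ∀ n, 1 ≤ n → n ≤ k → B₃ * (cR * epsOfRecord ν S.flow.g n) ≤ (1 - S.βc) * S.lf.alpha0 (S.flow.g n))
    (htI : ∀ n, 1 ≤ n → n ≤ k → B₃' * (cR * epsOfRecord ν S.flow.g n) ≤ S.cB * S.lf.alpha0 (S.flow.g n))
    (htMS : ∀ n, 1 ≤ n → n ≤ k → B₃' * (cR * epsOfRecord ν S.flow.g n) ≤ S.B * S.C * S.Mr * S.lf.alpha0 (S.flow.g n))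
    (hsN : ∀ n, 1 ≤ n → n ≤ k + 1 → ((B14.Eq213MaximalDomains.side (F.P K).L M n : ℕ) : ℤ) < (F.P K).sitesPerDir 0)
    (s : SeqOfRecord F ν M S.flow.g K k) (hsep : Sect2.SeqSeparated ν.M₁ s) (hM₁ : 0 < ν.M₁) (hc : c ≤ ν.M₁) {W : MSField (F.P K) (SU N)}
    (hcube : ∀ j, 1 ≤ j → j ≤ k → ∀ X : (Sect2.domSys (F.P K) M j).Dom, Sect2.domSites (F.P K) M j X ⊆ s.Λ j →
      ∀ a ∈ cubeIndices (F.P K) (B14.Eq213MaximalDomains.side (F.P K).L M (j + 1)),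
        (cubeEnl (F.P K) (B14.Eq213MaximalDomains.side (F.P K).L M (j + 1)) a 0 ∩ Sect2.domSites (F.P K) M j X).Nonempty →
        cubeEnl (F.P K) (B14.Eq213MaximalDomains.side (F.P K).L M (j + 1)) a 0 ⊆ s.Ω j)
    (h7 : Sect2.DataSmall7PTop (avOfRecord F N K) s.Ω (Sup ν K s.Ω) k (fun n => cR * epsOfRecord ν S.flow.g n) W)
    {U₀ : GaugeField (F.P K) 0 (SU N)} (hmin : IsMinimizer (avOfRecord F N K)
      {U | (∀ n, n ≤ k → PlaqSmallOn (Sect2.omegaPlaqsTop s.Ω (Sup ν K s.Ω) n) (ν.εreg * (F.P K).eta n ^ 2) U) ∧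
        Sect2.CoDivClassOnTop s.Ω (Sup ν K s.Ω) k ν.εreg U} (genSet s.Ω k) W U₀) :
    ∀ j, 1 ≤ j → j ≤ k → ∀ X : (Sect2.domSys (F.P K) M j).Dom,
      (Sect2.domSites (F.P K) M j X ⊆ s.Λ j →
        Sect2.ofBackgroundC S.ι (U₀) ∈
          Sect2.spaceI S (Sect2.Residual.unit (F.P K) (MatA N)) M j (Sect2.domSites (F.P K) M j X) (S.lf.alpha0 (S.flow.g j)) (S.lf.alpha1 (S.flow.g j))) ∧
      (Sect2.admB (F.P K) ν M S.flow.g s.Ω s.Λ j (Sect2.domSites (F.P K) M j X) = true →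
        Sect2.ofBackgroundC S.ι (U₀) ∈
          Sect2.spaceMS S (Sect2.Residual.unit (F.P K) (MatA N)) M j (Sect2.domSites (F.P K) M j X) s.Ω) := by
  have hplaq := plaqSmallOn_of_thm1RegSepTop7M h15 ν M S.flow.g K k cR s hsep hM₁ hnum ha₀ hcomp hcomp' h7 hmin
  have hclass : ∀ n, 1 ≤ n → n ≤ k → PlaqSmallOn (omegaPlaqs s.Ω n) (B₃ * (cR * epsOfRecord ν S.flow.g n) * (F.P K).eta n ^ 2) U₀ := by
    intro n hn1 hnk
    have := hplaq n hnk
    rwa [Sect2.omegaPlaqsTop_of_ne_zero _ _ (Nat.one_le_iff_ne_zero.mp hn1)] at this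
  have hg := localGaugeOn_of_thm1GaugeRegSepTop7MR h15G ν S.flow.g K k cR s hsep hM₁ hc hnum ha₀ hcomp hcomp' h7 hmin
  exact bgRowAtDatumU_of_classBoundsPos_of_localGauge_of_hcubeΩ S hι h𝓜 hS hpos ν K k s U₀ hcube hclass hα hBα htI htMS
    (fun n hn1 hnk => (hg n hn1 hnk).1 (hsN n hn1 (by omega))) (fun n hn1 hnk => (hg n hn1 hnk).2 (hsN (n + 1) (by omega) (by omega)))

/-- **§3 ★★ ROW P11's BODY AT `(s, 𝐖)` FOR def-R's COLLAR-CLASS MINIMISER `UbgMSCoPOfRecord … s 𝐖` — `hcubeΩ` AS A HYPOTHESIS** (B′'s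
`Record12BgRowCoClassGaugeR.bgRowAtDatumCoP_of_thm1RegSepCoP7M_of_thm1GaugeR` :238 VERBATIM with (C1)∕(C2) ↦ `hcube`; on the solvable set §2 at `isMinimizer_UbgMSCoPOfRecord`, off it the
junk `1` by `bgRowAtDatum_one`).
[cite: Balaban1985Variational, Thm 1 (2),(6)–(9) pp.278–279; Balaban1988Convergent, (2.6)–(2.8) pp.255–256, (2.12)–(2.13) p.256, (2.27)–(2.28) p.259, (2.34)–(2.41) p.261; Balaban1987RG1, (1.11)–(1.16) p.262] -/
theorem bgRowAtDatumCoP_of_thm1RegSepCoP7M_of_thm1GaugeR_of_hcubeΩ {M c : ℕ} {B₃ B₃' a₀ a₁ : ℝ} (h15 : VariationalThm1RegSepCoP7M F N B₃ a₀ a₁)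
    (h15G : VariationalThm1GaugeRegSepCoP7MR F N M c B₃ B₃' a₀ a₁)
    (S : Sect2.Setting (MatA N) (SU N)) (hι : S.ι = ιSU N) (h𝓜 : S.𝓜 = B12RegularSpaces111SpecialUnitary.suModel N) (hS : S.Laws) (hpos : S.Pos)
    (ν : Stage7Numerics) (K k : ℕ) (cR : ℝ)
    (hnum : ∀ n, n ≤ k → 0 < cR * epsOfRecord ν S.flow.g n ∧ cR * epsOfRecord ν S.flow.g n ≤ a₁ ∧ B₃ * (cR * epsOfRecord ν S.flow.g n) ≤ ν.εreg)
    (ha₀ : ν.εreg ≤ a₀) (hcomp : ∀ n, n < k → cR * epsOfRecord ν S.flow.g n ≤ 2 * (cR * epsOfRecord ν S.flow.g (n + 1)))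
    (hcomp' : ∀ n, n < k → cR * epsOfRecord ν S.flow.g (n + 1) ≤ 2 * (cR * epsOfRecord ν S.flow.g n))
    (hα : ∀ n, 1 ≤ n → n ≤ k → 0 < S.lf.alpha0 (S.flow.g n) ∧ 0 < S.lf.alpha1 (S.flow.g n))
    (hBα : ∀ n, 1 ≤ n → n ≤ k → B₃ * (cR * epsOfRecord ν S.flow.g n) ≤ (1 - S.βc) * S.lf.alpha0 (S.flow.g n))
    (htI : ∀ n, 1 ≤ n → n ≤ k → B₃' * (cR * epsOfRecord ν S.flow.g n) ≤ S.cB * S.lf.alpha0 (S.flow.g n))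
    (htMS : ∀ n, 1 ≤ n → n ≤ k → B₃' * (cR * epsOfRecord ν S.flow.g n) ≤ S.B * S.C * S.Mr * S.lf.alpha0 (S.flow.g n))
    (hsN : ∀ n, 1 ≤ n → n ≤ k + 1 → ((B14.Eq213MaximalDomains.side (F.P K).L M n : ℕ) : ℤ) < (F.P K).sitesPerDir 0)
    (s : SeqOfRecord F ν M S.flow.g K k) (hsep : Sect2.SeqSeparated ν.M₁ s) (hM₁ : 0 < ν.M₁) (hc : c ≤ ν.M₁) (W : MSField (F.P K) (SU N))
    (hcube : ∀ j, 1 ≤ j → j ≤ k → ∀ X : (Sect2.domSys (F.P K) M j).Dom, Sect2.domSites (F.P K) M j X ⊆ s.Λ j →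
      ∀ a ∈ cubeIndices (F.P K) (B14.Eq213MaximalDomains.side (F.P K).L M (j + 1)),
        (cubeEnl (F.P K) (B14.Eq213MaximalDomains.side (F.P K).L M (j + 1)) a 0 ∩ Sect2.domSites (F.P K) M j X).Nonempty →
        cubeEnl (F.P K) (B14.Eq213MaximalDomains.side (F.P K).L M (j + 1)) a 0 ⊆ s.Ω j)
    (h7 : Sect2.DataSmall7PTop (avOfRecord F N K) s.Ω (suppDomOfRecord F ν K s.Ω) k (fun n => cR * epsOfRecord ν S.flow.g n) W) :
    ∀ j, 1 ≤ j → j ≤ k → ∀ X : (Sect2.domSys (F.P K) M j).Dom,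
      (Sect2.domSites (F.P K) M j X ⊆ s.Λ j →
        Sect2.ofBackgroundC S.ι (UbgMSCoPOfRecord F N ν M S.flow.g K k s W) ∈
          Sect2.spaceI S (Sect2.Residual.unit (F.P K) (MatA N)) M j (Sect2.domSites (F.P K) M j X) (S.lf.alpha0 (S.flow.g j)) (S.lf.alpha1 (S.flow.g j))) ∧
      (Sect2.admB (F.P K) ν M S.flow.g s.Ω s.Λ j (Sect2.domSites (F.P K) M j X) = true →
        Sect2.ofBackgroundC S.ι (UbgMSCoPOfRecord F N ν M S.flow.g K k s W) ∈
          Sect2.spaceMS S (Sect2.Residual.unit (F.P K) (MatA N)) M j (Sect2.domSites (F.P K) M j X) s.Ω) := by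
  by_cases hsol : W ∈ solvableDom (avOfRecord F N K) (regMSCoPOfRecord F N ν K k s.Ω) (genSet s.Ω k)
  · exact bgRowAtDatumU_of_thm1RegSepTop7M_of_thm1GaugeR_of_hcubeΩ h15 h15G S hι h𝓜 hS hpos ν K k cR hnum ha₀ hcomp hcomp' hα hBα htI htMS hsN s hsep hM₁ hc
      hcube h7
      (isMinimizer_UbgMSCoPOfRecord ν M S.flow.g K k s hsol)
  · rw [UbgMSCoPOfRecord_eq_one_of_not_mem ν M S.flow.g K k s hsol]
    exact bgRowAtDatum_one S hpos ν M K k s hα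
end RowBody

/-! ## §4  The Stage-13 reduction — NO `PartCompat₁₃` antecedent -/
section Stage13
/-- **§4 ★★ ROW P11's BODY AT `UbgMSCoPOfRecord … n s 𝐖` AT THE STAGE-13 RECORD — NO RUN GUARD IN THE CONCLUSION, `hcubeΩ` RUN-INDEXED AS A HYPOTHESIS** (B′'s
`Stage13Params.bgAtDatumCoP_of_thm1RegSepCoP7M_of_thm1GaugeR` :303 with the antecedent `PartCompat₁₃ F N θ p n →` DELETED from the conclusion and (C1) replaced by `hcube`; `hsN` kept
as stated there — at `θ.τ9.M = F.L^a` with `a + 1 ≤ m` it holds on every run; every other letter verbatim).  With dag-n11-w4's `hcubeΩ_of_powM` («BG-ONEBLOCK» §1: K0b's lemma freed by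
the compatible-or-one-block dichotomy) `hcube` is discharged at every power-of-`L` basic cube from (C1) alone — §5 displays the witness form.
[cite: Balaban1985Variational, (6)–(7) p.278, Thm 1 (8)–(9) p.279, (152) p.301, Prop. 8 p.304; Balaban1985RegularSpaces, (1.3)–(1.9) p.77; Balaban1988Convergent, Thm 1 p.262, (2.4)–(2.8) pp.255–256, (2.12)–(2.13) p.256, (2.27)–(2.28) p.259, (2.34)–(2.41) p.261; Balaban1987RG1, (1.11)–(1.12) p.262] -/
theorem stage13_bgAtDatumCoP_of_thm1RegSepCoP7M_of_thm1GaugeR_of_hcubeΩ (θ : Stage13Params F N) (hθ : θ.Admissible F N) (hRz : θ.Rz = RzOfRecord F N)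
    {c : ℕ} {B₃ B₃' a₀ a₁ : ℝ} (hc : c ≤ θ.ν.M₁)
    (h15 : VariationalThm1RegSepCoP7M F N B₃ a₀ a₁) (h15G : VariationalThm1GaugeRegSepCoP7MR F N θ.τ9.M c B₃ B₃' a₀ a₁)
    (hnum : ∀ (p : B12.RunParams) (n : ℕ), n ≤ p.K → Step.InInterval θ.γ n (gOfRecord₁₃ F N θ p) → ∀ m, m ≤ n →
      0 < θ.s2.cR * epsOfRecord θ.ν (gOfRecord₁₃ F N θ p) m ∧ θ.s2.cR * epsOfRecord θ.ν (gOfRecord₁₃ F N θ p) m ≤ a₁ ∧ B₃ * (θ.s2.cR * epsOfRecord θ.ν (gOfRecord₁₃ F N θ p) m) ≤ θ.ν.εreg)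
    (ha₀ : θ.ν.εreg ≤ a₀)
    (hcomp : ∀ (p : B12.RunParams) (n : ℕ), n ≤ p.K → Step.InInterval θ.γ n (gOfRecord₁₃ F N θ p) → ∀ m, m < n →
      θ.s2.cR * epsOfRecord θ.ν (gOfRecord₁₃ F N θ p) m ≤ 2 * (θ.s2.cR * epsOfRecord θ.ν (gOfRecord₁₃ F N θ p) (m + 1)))
    (hcomp' : ∀ (p : B12.RunParams) (n : ℕ), n ≤ p.K → Step.InInterval θ.γ n (gOfRecord₁₃ F N θ p) → ∀ m, m < n →
      θ.s2.cR * epsOfRecord θ.ν (gOfRecord₁₃ F N θ p) (m + 1) ≤ 2 * (θ.s2.cR * epsOfRecord θ.ν (gOfRecord₁₃ F N θ p) m))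
    (hBα : ∀ (p : B12.RunParams) (n : ℕ), n ≤ p.K → Step.InInterval θ.γ n (gOfRecord₁₃ F N θ p) → ∀ m, 1 ≤ m → m ≤ n →
      B₃ * (θ.s2.cR * epsOfRecord θ.ν (gOfRecord₁₃ F N θ p) m) ≤ (1 - θ.s2.βc) * (lfOfRecord₁₂ F N θ.toStage12Params).alpha0 (gOfRecord₁₃ F N θ p m))
    (htI : ∀ (p : B12.RunParams) (n : ℕ), n ≤ p.K → Step.InInterval θ.γ n (gOfRecord₁₃ F N θ p) → ∀ m, 1 ≤ m → m ≤ n →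
      B₃' * (θ.s2.cR * epsOfRecord θ.ν (gOfRecord₁₃ F N θ p) m) ≤ θ.s2.cB * (lfOfRecord₁₂ F N θ.toStage12Params).alpha0 (gOfRecord₁₃ F N θ p m))
    (htMS : ∀ (p : B12.RunParams) (n : ℕ), n ≤ p.K → Step.InInterval θ.γ n (gOfRecord₁₃ F N θ p) → ∀ m, 1 ≤ m → m ≤ n →
      B₃' * (θ.s2.cR * epsOfRecord θ.ν (gOfRecord₁₃ F N θ p) m) ≤ θ.s2.B * θ.s2.C * θ.s2.Mr * (lfOfRecord₁₂ F N θ.toStage12Params).alpha0 (gOfRecord₁₃ F N θ p m))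
    (hcube : ∀ (p : B12.RunParams) (n : ℕ), n ≤ p.K → Step.InInterval θ.γ n (gOfRecord₁₃ F N θ p) →
      ∀ s : SeqOfRecord F θ.ν θ.τ9.M (gOfRecord₁₃ F N θ p) p.K n, ∀ j, 1 ≤ j → j ≤ n →
      ∀ X : (Sect2.domSys (F.P p.K) θ.τ9.M j).Dom, Sect2.domSites (F.P p.K) θ.τ9.M j X ⊆ s.Λ j →
      ∀ a ∈ cubeIndices (F.P p.K) (B14.Eq213MaximalDomains.side (F.P p.K).L θ.τ9.M (j + 1)),
        (cubeEnl (F.P p.K) (B14.Eq213MaximalDomains.side (F.P p.K).L θ.τ9.M (j + 1)) a 0 ∩ Sect2.domSites (F.P p.K) θ.τ9.M j X).Nonempty →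
        cubeEnl (F.P p.K) (B14.Eq213MaximalDomains.side (F.P p.K).L θ.τ9.M (j + 1)) a 0 ⊆ s.Ω j)
    (hsN : ∀ (p : B12.RunParams) (n : ℕ), n ≤ p.K → ∀ n', 1 ≤ n' → n' ≤ n + 1 →
      ((B14.Eq213MaximalDomains.side (F.P p.K).L θ.τ9.M n' : ℕ) : ℤ) < (F.P p.K).sitesPerDir 0) :
    ∀ (p : B12.RunParams) (n : ℕ), n ≤ p.K → Step.InInterval θ.γ n (gOfRecord₁₃ F N θ p) →
      ∀ s : SeqOfRecord F θ.ν θ.τ9.M (gOfRecord₁₃ F N θ p) p.K n, Sect2.SeqSeparated θ.ν.M₁ s → 0 < θ.ν.M₁ → ∀ W : MSField (F.P p.K) (SU N),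
      Sect2.DataSmall7PTop (avOfRecord F N p.K) s.Ω (suppDomOfRecord F θ.ν p.K s.Ω) n (fun j => θ.s2.cR * epsOfRecord θ.ν (gOfRecord₁₃ F N θ p) j) W →
      ∀ j, 1 ≤ j → j ≤ n → ∀ X : (Sect2.domSys (F.P p.K) θ.τ9.M j).Dom,
      (Sect2.domSites (F.P p.K) θ.τ9.M j X ⊆ s.Λ j →
        Sect2.ofBackgroundC (settingOfRecord₁₃ F N θ p).ι (UbgMSCoPOfRecord F N θ.ν θ.τ9.M (gOfRecord₁₃ F N θ p) p.K n s W) ∈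
          Sect2.spaceI (settingOfRecord₁₃ F N θ p) (θ.Rz p.K) θ.τ9.M j (Sect2.domSites (F.P p.K) θ.τ9.M j X)
            ((settingOfRecord₁₃ F N θ p).lf.alpha0 ((settingOfRecord₁₃ F N θ p).flow.g j)) ((settingOfRecord₁₃ F N θ p).lf.alpha1 ((settingOfRecord₁₃ F N θ p).flow.g j))) ∧
      (Sect2.admB (F.P p.K) θ.ν θ.τ9.M (gOfRecord₁₃ F N θ p) s.Ω s.Λ j (Sect2.domSites (F.P p.K) θ.τ9.M j X) = true →
        Sect2.ofBackgroundC (settingOfRecord₁₃ F N θ p).ι (UbgMSCoPOfRecord F N θ.ν θ.τ9.M (gOfRecord₁₃ F N θ p) p.K n s W) ∈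
          Sect2.spaceMS (settingOfRecord₁₃ F N θ p) (θ.Rz p.K) θ.τ9.M j (Sect2.domSites (F.P p.K) θ.τ9.M j X) s.Ω) := by
  intro p n hn hw s hsep hM₁ W h7
  rw [hRz]
  exact bgRowAtDatumCoP_of_thm1RegSepCoP7M_of_thm1GaugeR_of_hcubeΩ h15 h15G (settingOfRecord₁₃ F N θ p) rfl rfl (settingOfRecord₁₃_laws F N θ p)
    (settingOfRecord₁₃_pos F N θ hθ.1.pos p) θ.ν p.K n θ.s2.cR (hnum p n hn hw) ha₀ (hcomp p n hn hw) (hcomp' p n hn hw)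
    (fun m _ hm => alphaPos₁₃_of_inInterval hθ hw hm) (hBα p n hn hw) (htI p n hn hw) (htMS p n hn hw) (hsN p n hn) s hsep hM₁ hc W (hcube p n hn hw s) h7
end Stage13

/-! ## §5  At K1's witness of record `θ₁₅ᶜᶜᴹᵂ(j; γ)`, non-wrapping families — NO `PartCompat₁₃` antecedent -/
section Witness
variable {j c : ℕ} {γ ε₀ ε₂₉ B₃ B₃' a₀ a₁ : ℝ}

/-- **§5 ★★★ AT K1's WITNESS `θ₁₅ᶜᶜᴹᵂ(j; γ)` ON A NON-WRAPPING FAMILY (`j + 1 ≤ F.m`): THE (7)-GUARDED SEPARATED ROW P11 BODY ON EVERY WINDOW RUN — NO RUN GUARD**, from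
`0 < γ ≤ ½`, (8), the R gauge sentence, (hcomp) ∧ (hcompRev) and the run-indexed cube inclusion `hcube` (dag-n21-c's Eʷ ★★★ʷʰ `bgSepCoPAt_theta13OfThm1CCMW_of_thm1GaugeR_of_hcomp` with the
antecedent `PartCompat₁₃ … p n →` DELETED from the conclusion: `hsN` from `hjm` by `hsN_theta13OfThm1CCMW`, (C1) replaced by `hcube`; statement otherwise verbatim).  `hcube` is
dag-n11-w4's «BG-ONEBLOCK» §1 `hcubeΩ_of_powM` at `M = L^j` ∘ A2ʷ `hC1_theta13OfThm1CCMW hγ` — one line for the consumer once that file is in the tree.  The wrapping families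
`F.m ≤ j` (`not_hsN_theta13OfThm1CCMW_of_le`) are NOT served: there the (1.12) cubes wrap (dag-n21-c's `exists_wrap_witness_top`) — the genuine global residue of «BG-ONEBLOCK».
CONDITIONAL; nothing of Bałaban asserted. [cite: Balaban1985Variational, (6)–(7) p.278, Thm 1 (8)–(9) p.279, (144)–(152) pp.300–301, Prop. 8 p.304; Balaban1985RegularSpaces, (1.3)–(1.9) p.77; Balaban1988Convergent, Thm 1 p.262, (2.1) p.254, (2.4)–(2.8) pp.255–256, (2.12)–(2.13) pp.256–257, (2.18) p.257, (2.25)–(2.28) pp.258–259; Balaban1987RG1, Thm 1 p.259, (1.12) p.262] -/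
theorem bgSepCoPAt_theta13OfThm1CCMW_of_thm1GaugeR_of_hcomp_of_hjm_of_hcubeΩ (hγ0 : 0 < γ) (hγ : γ ≤ 1 / 2) (hjm : j + 1 ≤ F.m) (hε : 0 < ε₀) (hε' : 0 < ε₂₉) (hB : 0 ≤ B₃) (hB' : 0 ≤ B₃') (ha₀ : 0 < a₀) (ha₁ : 0 < a₁)
    (h15 : VariationalThm1RegSepCoP7M F N B₃ a₀ a₁) (hc : c ≤ F.L ^ j) (h15G : VariationalThm1GaugeRegSepCoP7MR F N (F.L ^ j) c B₃ B₃' a₀ a₁)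
    (hcomp : ∀ (p : B12.RunParams) (n : ℕ), n ≤ p.K → Step.InInterval (theta13OfThm1CCMW F N j γ ε₀ ε₂₉ B₃ B₃' a₀ a₁).γ n (gOfRecord₁₃ F N (theta13OfThm1CCMW F N j γ ε₀ ε₂₉ B₃ B₃' a₀ a₁) p) → ∀ m, m < n →
      (theta13OfThm1CCMW F N j γ ε₀ ε₂₉ B₃ B₃' a₀ a₁).s2.cR * epsOfRecord (theta13OfThm1CCMW F N j γ ε₀ ε₂₉ B₃ B₃' a₀ a₁).ν (gOfRecord₁₃ F N (theta13OfThm1CCMW F N j γ ε₀ ε₂₉ B₃ B₃' a₀ a₁) p) m ≤ 2 * ((theta13OfThm1CCMW F N j γ ε₀ ε₂₉ B₃ B₃' a₀ a₁).s2.cR * epsOfRecord (theta13OfThm1CCMW F N j γ ε₀ ε₂₉ B₃ B₃' a₀ a₁).ν (gOfRecord₁₃ F N (theta13OfThm1CCMW F N j γ ε₀ ε₂₉ B₃ B₃' a₀ a₁) p) (m + 1)))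
    (hcompRev : ∀ (p : B12.RunParams) (n : ℕ), n ≤ p.K → Step.InInterval (theta13OfThm1CCMW F N j γ ε₀ ε₂₉ B₃ B₃' a₀ a₁).γ n (gOfRecord₁₃ F N (theta13OfThm1CCMW F N j γ ε₀ ε₂₉ B₃ B₃' a₀ a₁) p) → ∀ m, m < n →
      (theta13OfThm1CCMW F N j γ ε₀ ε₂₉ B₃ B₃' a₀ a₁).s2.cR * epsOfRecord (theta13OfThm1CCMW F N j γ ε₀ ε₂₉ B₃ B₃' a₀ a₁).ν (gOfRecord₁₃ F N (theta13OfThm1CCMW F N j γ ε₀ ε₂₉ B₃ B₃' a₀ a₁) p) (m + 1) ≤ 2 * ((theta13OfThm1CCMW F N j γ ε₀ ε₂₉ B₃ B₃' a₀ a₁).s2.cR * epsOfRecord (theta13OfThm1CCMW F N j γ ε₀ ε₂₉ B₃ B₃' a₀ a₁).ν (gOfRecord₁₃ F N (theta13OfThm1CCMW F N j γ ε₀ ε₂₉ B₃ B₃' a₀ a₁) p) m))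
    (hcube : ∀ (p : B12.RunParams) (n : ℕ), n ≤ p.K → Step.InInterval (theta13OfThm1CCMW F N j γ ε₀ ε₂₉ B₃ B₃' a₀ a₁).γ n (gOfRecord₁₃ F N (theta13OfThm1CCMW F N j γ ε₀ ε₂₉ B₃ B₃' a₀ a₁) p) →
      ∀ s : SeqOfRecord F (theta13OfThm1CCMW F N j γ ε₀ ε₂₉ B₃ B₃' a₀ a₁).ν (theta13OfThm1CCMW F N j γ ε₀ ε₂₉ B₃ B₃' a₀ a₁).τ9.M (gOfRecord₁₃ F N (theta13OfThm1CCMW F N j γ ε₀ ε₂₉ B₃ B₃' a₀ a₁) p) p.K n, ∀ j', 1 ≤ j' → j' ≤ n →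
      ∀ X : (Sect2.domSys (F.P p.K) (theta13OfThm1CCMW F N j γ ε₀ ε₂₉ B₃ B₃' a₀ a₁).τ9.M j').Dom, Sect2.domSites (F.P p.K) (theta13OfThm1CCMW F N j γ ε₀ ε₂₉ B₃ B₃' a₀ a₁).τ9.M j' X ⊆ s.Λ j' →
      ∀ a ∈ cubeIndices (F.P p.K) (B14.Eq213MaximalDomains.side (F.P p.K).L (theta13OfThm1CCMW F N j γ ε₀ ε₂₉ B₃ B₃' a₀ a₁).τ9.M (j' + 1)),
        (cubeEnl (F.P p.K) (B14.Eq213MaximalDomains.side (F.P p.K).L (theta13OfThm1CCMW F N j γ ε₀ ε₂₉ B₃ B₃' a₀ a₁).τ9.M (j' + 1)) a 0 ∩ Sect2.domSites (F.P p.K) (theta13OfThm1CCMW F N j γ ε₀ ε₂₉ B₃ B₃' a₀ a₁).τ9.M j' X).Nonempty →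
        cubeEnl (F.P p.K) (B14.Eq213MaximalDomains.side (F.P p.K).L (theta13OfThm1CCMW F N j γ ε₀ ε₂₉ B₃ B₃' a₀ a₁).τ9.M (j' + 1)) a 0 ⊆ s.Ω j') :
    ∀ (p : B12.RunParams) (n : ℕ), n ≤ p.K → Step.InInterval (theta13OfThm1CCMW F N j γ ε₀ ε₂₉ B₃ B₃' a₀ a₁).γ n (gOfRecord₁₃ F N (theta13OfThm1CCMW F N j γ ε₀ ε₂₉ B₃ B₃' a₀ a₁) p) →
      ∀ s : SeqOfRecord F (theta13OfThm1CCMW F N j γ ε₀ ε₂₉ B₃ B₃' a₀ a₁).ν (theta13OfThm1CCMW F N j γ ε₀ ε₂₉ B₃ B₃' a₀ a₁).τ9.M (gOfRecord₁₃ F N (theta13OfThm1CCMW F N j γ ε₀ ε₂₉ B₃ B₃' a₀ a₁) p) p.K n, Sect2.SeqSeparated (theta13OfThm1CCMW F N j γ ε₀ ε₂₉ B₃ B₃' a₀ a₁).ν.M₁ s →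
      ∀ W : MSField (F.P p.K) (SU N), W ∈ suppOfRecord₁₃P F N (theta13OfThm1CCMW F N j γ ε₀ ε₂₉ B₃ B₃' a₀ a₁) p n s →
      Sect2.DataSmall7PTop (avOfRecord F N p.K) s.Ω (suppDomOfRecord F (theta13OfThm1CCMW F N j γ ε₀ ε₂₉ B₃ B₃' a₀ a₁).ν p.K s.Ω) n (fun j' => (theta13OfThm1CCMW F N j γ ε₀ ε₂₉ B₃ B₃' a₀ a₁).s2.cR * epsOfRecord (theta13OfThm1CCMW F N j γ ε₀ ε₂₉ B₃ B₃' a₀ a₁).ν (gOfRecord₁₃ F N (theta13OfThm1CCMW F N j γ ε₀ ε₂₉ B₃ B₃' a₀ a₁) p) j') W →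
      ∀ j', 1 ≤ j' → j' ≤ n → ∀ X : (Sect2.domSys (F.P p.K) (theta13OfThm1CCMW F N j γ ε₀ ε₂₉ B₃ B₃' a₀ a₁).τ9.M j').Dom,
      (Sect2.domSites (F.P p.K) (theta13OfThm1CCMW F N j γ ε₀ ε₂₉ B₃ B₃' a₀ a₁).τ9.M j' X ⊆ s.Λ j' →
        Sect2.ofBackgroundC (settingOfRecord₁₃ F N (theta13OfThm1CCMW F N j γ ε₀ ε₂₉ B₃ B₃' a₀ a₁) p).ι (UbgOfRecord₁₃CoP F N (theta13OfThm1CCMW F N j γ ε₀ ε₂₉ B₃ B₃' a₀ a₁) p n s W) ∈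
          Sect2.spaceI (settingOfRecord₁₃ F N (theta13OfThm1CCMW F N j γ ε₀ ε₂₉ B₃ B₃' a₀ a₁) p) ((theta13OfThm1CCMW F N j γ ε₀ ε₂₉ B₃ B₃' a₀ a₁).Rz p.K) (theta13OfThm1CCMW F N j γ ε₀ ε₂₉ B₃ B₃' a₀ a₁).τ9.M j' (Sect2.domSites (F.P p.K) (theta13OfThm1CCMW F N j γ ε₀ ε₂₉ B₃ B₃' a₀ a₁).τ9.M j' X)
            ((settingOfRecord₁₃ F N (theta13OfThm1CCMW F N j γ ε₀ ε₂₉ B₃ B₃' a₀ a₁) p).lf.alpha0 ((settingOfRecord₁₃ F N (theta13OfThm1CCMW F N j γ ε₀ ε₂₉ B₃ B₃' a₀ a₁) p).flow.g j')) ((settingOfRecord₁₃ F N (theta13OfThm1CCMW F N j γ ε₀ ε₂₉ B₃ B₃' a₀ a₁) p).lf.alpha1 ((settingOfRecord₁₃ F N (theta13OfThm1CCMW F N j γ ε₀ ε₂₉ B₃ B₃' a₀ a₁) p).flow.g j'))) ∧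
      (Sect2.admB (F.P p.K) (theta13OfThm1CCMW F N j γ ε₀ ε₂₉ B₃ B₃' a₀ a₁).ν (theta13OfThm1CCMW F N j γ ε₀ ε₂₉ B₃ B₃' a₀ a₁).τ9.M (gOfRecord₁₃ F N (theta13OfThm1CCMW F N j γ ε₀ ε₂₉ B₃ B₃' a₀ a₁) p) s.Ω s.Λ j' (Sect2.domSites (F.P p.K) (theta13OfThm1CCMW F N j γ ε₀ ε₂₉ B₃ B₃' a₀ a₁).τ9.M j' X) = true →
        Sect2.ofBackgroundC (settingOfRecord₁₃ F N (theta13OfThm1CCMW F N j γ ε₀ ε₂₉ B₃ B₃' a₀ a₁) p).ι (UbgOfRecord₁₃CoP F N (theta13OfThm1CCMW F N j γ ε₀ ε₂₉ B₃ B₃' a₀ a₁) p n s W) ∈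
          Sect2.spaceMS (settingOfRecord₁₃ F N (theta13OfThm1CCMW F N j γ ε₀ ε₂₉ B₃ B₃' a₀ a₁) p) ((theta13OfThm1CCMW F N j γ ε₀ ε₂₉ B₃ B₃' a₀ a₁).Rz p.K) (theta13OfThm1CCMW F N j γ ε₀ ε₂₉ B₃ B₃' a₀ a₁).τ9.M j' (Sect2.domSites (F.P p.K) (theta13OfThm1CCMW F N j γ ε₀ ε₂₉ B₃ B₃' a₀ a₁).τ9.M j' X) s.Ω) := by
  intro p n hn hw s hsep W _ h7
  cases n with
  | zero => intro j' h1 hj'; exfalso; omega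
  | succ n =>
    rw [UbgOfRecord₁₃CoP_succ]
    exact stage13_bgAtDatumCoP_of_thm1RegSepCoP7M_of_thm1GaugeR_of_hcubeΩ (theta13OfThm1CCMW F N j γ ε₀ ε₂₉ B₃ B₃' a₀ a₁) (admissible_theta13OfThm1CCMW_of_le_half F N hγ0 hγ hε hε' hB hB' ha₀ ha₁) rfl
      (by rw [theta13OfThm1CCMW_M₁]; exact hc) h15 h15G (hnum_theta13OfThm1CCMW hγ hB hB' ha₀ ha₁) εreg_le_theta13OfThm1CCMW
      hcomp hcompRev (hBα_theta13OfThm1CCMW hγ hB hB' ha₀.le ha₁.le)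
      (htI_theta13OfThm1CCMW hγ hB hB' ha₀.le ha₁.le) (htMS_theta13OfThm1CCMW hγ hB hB' ha₀.le ha₁.le) hcube (hsN_theta13OfThm1CCMW F N γ ε₀ ε₂₉ B₃ B₃' a₀ a₁ hjm)
      p (n + 1) hn hw s hsep (M₁_pos_theta13OfThm1CCMW F N j γ ε₀ ε₂₉ B₃ B₃' a₀ a₁) W h7

/-- **§6 ★★★ ROW P11 `bg` IN ITS OWN CURRENCY AT K1's WITNESS, NON-WRAPPING FAMILIES, EVERY WINDOW RUN — NO RUN GUARD**: def-R's ranged proviso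
`BgProvisoΛ F N p.K (settingOfRecord₁₃ …) (θ.Rz p.K) θ.τ9.M n (suppOfRecord₁₃SepCoP …) (UbgOfRecord₁₃CoP …)` — the exact TYPE of `Provisos₁₃SepCoPH.bg`'s consequent and of dag-n11-w1 g3's
`hbg`-binders (`…OfBgFact(s)`) — at `θ := θ₁₅ᶜᶜᴹᵂ(j; γ)`, `j + 1 ≤ F.m`, for EVERY run `p` and EVERY length `n ≤ K` in the window, from §5 through K0a's support adapter (membership in
`suppOfRecord₁₃SepCoP` = ⟨regular support, separation, (7)-regularity⟩, `Record13SepCoPLiveSelector` :48's `fun … s W hW => … s hW.2.1 W hW.1 hW.2.2`).  Hypotheses: (8), (9),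
(hcomp) ∧ (hcompRev), the window letters, `hjm`, `hcube` — and NOT `PartCompat₁₃`. [cite: Balaban1988Convergent, (2.28) p.259, (2.18) p.257, Thm 1 p.262; Balaban1985Variational, (6)–(7) p.278, Thm 1 (8)–(9) p.279; Balaban1985RegularSpaces, (1.3)–(1.6) p.77] -/
theorem bgProvisoΛ_theta13OfThm1CCMW_of_thm1GaugeR_of_hcomp_of_hjm_of_hcubeΩ (hγ0 : 0 < γ) (hγ : γ ≤ 1 / 2) (hjm : j + 1 ≤ F.m) (hε : 0 < ε₀) (hε' : 0 < ε₂₉) (hB : 0 ≤ B₃) (hB' : 0 ≤ B₃') (ha₀ : 0 < a₀) (ha₁ : 0 < a₁)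
    (h15 : VariationalThm1RegSepCoP7M F N B₃ a₀ a₁) (hc : c ≤ F.L ^ j) (h15G : VariationalThm1GaugeRegSepCoP7MR F N (F.L ^ j) c B₃ B₃' a₀ a₁)
    (hcomp : ∀ (p : B12.RunParams) (n : ℕ), n ≤ p.K → Step.InInterval (theta13OfThm1CCMW F N j γ ε₀ ε₂₉ B₃ B₃' a₀ a₁).γ n (gOfRecord₁₃ F N (theta13OfThm1CCMW F N j γ ε₀ ε₂₉ B₃ B₃' a₀ a₁) p) → ∀ m, m < n →
      (theta13OfThm1CCMW F N j γ ε₀ ε₂₉ B₃ B₃' a₀ a₁).s2.cR * epsOfRecord (theta13OfThm1CCMW F N j γ ε₀ ε₂₉ B₃ B₃' a₀ a₁).ν (gOfRecord₁₃ F N (theta13OfThm1CCMW F N j γ ε₀ ε₂₉ B₃ B₃' a₀ a₁) p) m ≤ 2 * ((theta13OfThm1CCMW F N j γ ε₀ ε₂₉ B₃ B₃' a₀ a₁).s2.cR * epsOfRecord (theta13OfThm1CCMW F N j γ ε₀ ε₂₉ B₃ B₃' a₀ a₁).ν (gOfRecord₁₃ F N (theta13OfThm1CCMW F N j γ ε₀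 ε₂₉ B₃ B₃' a₀ a₁) p) (m + 1)))
    (hcompRev : ∀ (p : B12.RunParams) (n : ℕ), n ≤ p.K → Step.InInterval (theta13OfThm1CCMW F N j γ ε₀ ε₂₉ B₃ B₃' a₀ a₁).γ n (gOfRecord₁₃ F N (theta13OfThm1CCMW F N j γ ε₀ ε₂₉ B₃ B₃' a₀ a₁) p) → ∀ m, m < n →
      (theta13OfThm1CCMW F N j γ ε₀ ε₂₉ B₃ B₃' a₀ a₁).s2.cR * epsOfRecord (theta13OfThm1CCMW F N j γ ε₀ ε₂₉ B₃ B₃' a₀ a₁).ν (gOfRecord₁₃ F N (theta13OfThm1CCMW F N j γ ε₀ ε₂₉ B₃ B₃' a₀ a₁) p) (m + 1) ≤ 2 * ((theta13OfThm1CCMW F N j γ ε₀ ε₂₉ B₃ B₃' a₀ a₁).s2.cR * epsOfRecord (theta13OfThm1CCMW F N j γ ε₀ ε₂₉ B₃ B₃' a₀ a₁).ν (gOfRecord₁₃ F N (theta13OfThm1CCMW F N j γ ε₀ ε₂₉ B₃ B₃' a₀ a₁) p) m))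
    (hcube : ∀ (p : B12.RunParams) (n : ℕ), n ≤ p.K → Step.InInterval (theta13OfThm1CCMW F N j γ ε₀ ε₂₉ B₃ B₃' a₀ a₁).γ n (gOfRecord₁₃ F N (theta13OfThm1CCMW F N j γ ε₀ ε₂₉ B₃ B₃' a₀ a₁) p) →
      ∀ s : SeqOfRecord F (theta13OfThm1CCMW F N j γ ε₀ ε₂₉ B₃ B₃' a₀ a₁).ν (theta13OfThm1CCMW F N j γ ε₀ ε₂₉ B₃ B₃' a₀ a₁).τ9.M (gOfRecord₁₃ F N (theta13OfThm1CCMW F N j γ ε₀ ε₂₉ B₃ B₃' a₀ a₁) p) p.K n, ∀ j', 1 ≤ j' → j' ≤ n →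
      ∀ X : (Sect2.domSys (F.P p.K) (theta13OfThm1CCMW F N j γ ε₀ ε₂₉ B₃ B₃' a₀ a₁).τ9.M j').Dom, Sect2.domSites (F.P p.K) (theta13OfThm1CCMW F N j γ ε₀ ε₂₉ B₃ B₃' a₀ a₁).τ9.M j' X ⊆ s.Λ j' →
      ∀ a ∈ cubeIndices (F.P p.K) (B14.Eq213MaximalDomains.side (F.P p.K).L (theta13OfThm1CCMW F N j γ ε₀ ε₂₉ B₃ B₃' a₀ a₁).τ9.M (j' + 1)),
        (cubeEnl (F.P p.K) (B14.Eq213MaximalDomains.side (F.P p.K).L (theta13OfThm1CCMW F N j γ ε₀ ε₂₉ B₃ B₃' a₀ a₁).τ9.M (j' + 1)) a 0 ∩ Sect2.domSites (F.P p.K) (theta13OfThm1CCMW F N j γ ε₀ ε₂₉ B₃ B₃' a₀ a₁).τ9.M j' X).Nonempty →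
        cubeEnl (F.P p.K) (B14.Eq213MaximalDomains.side (F.P p.K).L (theta13OfThm1CCMW F N j γ ε₀ ε₂₉ B₃ B₃' a₀ a₁).τ9.M (j' + 1)) a 0 ⊆ s.Ω j') :
    ∀ (p : B12.RunParams) (n : ℕ), n ≤ p.K → Step.InInterval (theta13OfThm1CCMW F N j γ ε₀ ε₂₉ B₃ B₃' a₀ a₁).γ n (gOfRecord₁₃ F N (theta13OfThm1CCMW F N j γ ε₀ ε₂₉ B₃ B₃' a₀ a₁) p) →
      BgProvisoΛ F N p.K (settingOfRecord₁₃ F N (theta13OfThm1CCMW F N j γ ε₀ ε₂₉ B₃ B₃' a₀ a₁) p) ((theta13OfThm1CCMW F N j γ ε₀ ε₂₉ B₃ B₃' a₀ a₁).Rz p.K) (theta13OfThm1CCMW F N j γ ε₀ ε₂₉ B₃ B₃' a₀ a₁).τ9.M n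
        (suppOfRecord₁₃SepCoP F N (theta13OfThm1CCMW F N j γ ε₀ ε₂₉ B₃ B₃' a₀ a₁) p n) (UbgOfRecord₁₃CoP F N (theta13OfThm1CCMW F N j γ ε₀ ε₂₉ B₃ B₃' a₀ a₁) p n) := by
  intro p n hn hw s W hW
  exact bgSepCoPAt_theta13OfThm1CCMW_of_thm1GaugeR_of_hcomp_of_hjm_of_hcubeΩ hγ0 hγ hjm hε hε' hB hB' ha₀ ha₁ h15 hc h15G hcomp hcompRev hcube
    p n hn hw s hW.2.1 W hW.1 hW.2.2
end Witness

/-! ## §7  (Stage-2 train, PRE-CAMPAIGN additive; WORKPLAN-IIIB (iii-b), №343 (D5)∕(D6), №347; TRAIN-N11 T2-(7)(a)) §2 and §4 over the guarded `(Adm, bd, Dat)` sentences, background-generic -/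

/-- **§7.1 ★★ ROW P11's BODY FOR EVERY `bd`-MINIMISER `U₀` OVER THE TOP-DOMAIN CLASS (6), `(Adm, bd, Dat)`-GENERIC, `hcubeΩ` AS A HYPOTHESIS** — §2 with the (b) sentences
replaced by S1a-C `VariationalThm1RegSepTop7MGB F N Sup Adm bd Dat …` ∕ S1b-2 `VariationalThm1GaugeRegSepTop7MGB F N Sup M Adm bd Dat …` (rows `hadm`, `h7 : Dat …`, `IsMinimizerB … (bd K k s.Ω) W U₀`);
closing term §1; w1's `…GaugeRGuardedBRow` §1 pattern (FLAG №16 ∕ LOCATE-HSEAM 5d3298b8d191f169); §2 stays landed and true; the sentences are named facts, never asserted. [cite: Balaban1985Variational, Thm 1 (2),(6)–(9) pp.278–279; Balaban1984PropagatorsII, (2.3) p.224; Balaban1988Convergent, (2.12)–(2.13) p.256, (2.27)–(2.28) p.259, (2.34)–(2.41) p.261; Balaban1987RG1, (1.11)–(1.16) p.262] -/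
theorem bgRowAtDatumU_of_thm1RegSepTop7MGB_of_thm1GaugeGB_of_hcubeΩ {Sup : (ν : Stage7Numerics) → (K : ℕ) → (ℕ → Set (Site (F.P K) 0)) → Set (Site (F.P K) 0)} {M : ℕ}
    {Adm : StepGuard F} {bd : BondDatum F} {Dat : TopData F N} {B₃ B₃' a₀ a₁ : ℝ} (h15 : VariationalThm1RegSepTop7MGB F N Sup Adm bd Dat B₃ a₀ a₁)
    (h15G : VariationalThm1GaugeRegSepTop7MGB F N Sup M Adm bd Dat B₃ B₃' a₀ a₁)
    (S : Sect2.Setting (MatA N) (SU N)) (hι : S.ι = ιSU N) (h𝓜 : S.𝓜 = B12RegularSpaces111SpecialUnitary.suModel N) (hS : S.Laws) (hpos : S.Pos)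
    (ν : Stage7Numerics) (K k : ℕ) (cR : ℝ)
    (hnum : ∀ n, n ≤ k → 0 < cR * epsOfRecord ν S.flow.g n ∧ cR * epsOfRecord ν S.flow.g n ≤ a₁ ∧ B₃ * (cR * epsOfRecord ν S.flow.g n) ≤ ν.εreg)
    (ha₀ : ν.εreg ≤ a₀) (hcomp : ∀ n, n < k → cR * epsOfRecord ν S.flow.g n ≤ 2 * (cR * epsOfRecord ν S.flow.g (n + 1)))
    (hcomp' : ∀ n, n < k → cR * epsOfRecord ν S.flow.g (n + 1) ≤ 2 * (cR * epsOfRecord ν S.flow.g n))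
    (hα : ∀ n, 1 ≤ n → n ≤ k → 0 < S.lf.alpha0 (S.flow.g n) ∧ 0 < S.lf.alpha1 (S.flow.g n))
    (hBα : ∀ n, 1 ≤ n → n ≤ k → B₃ * (cR * epsOfRecord ν S.flow.g n) ≤ (1 - S.βc) * S.lf.alpha0 (S.flow.g n))
    (htI : ∀ n, 1 ≤ n → n ≤ k → B₃' * (cR * epsOfRecord ν S.flow.g n) ≤ S.cB * S.lf.alpha0 (S.flow.g n))
    (htMS : ∀ n, 1 ≤ n → n ≤ k → B₃' * (cR * epsOfRecord ν S.flow.g n) ≤ S.B * S.C * S.Mr * S.lf.alpha0 (S.flow.g n))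
    (hsN : ∀ n, 1 ≤ n → n ≤ k + 1 → ((B14.Eq213MaximalDomains.side (F.P K).L M n : ℕ) : ℤ) < (F.P K).sitesPerDir 0)
    (s : SeqOfRecord F ν M S.flow.g K k) (hsep : Sect2.SeqSeparated ν.M₁ s) (hM₁ : 0 < ν.M₁) (hadm : Adm ν M S.flow.g K k s) {W : MSField (F.P K) (SU N)}
    (hcube : ∀ j, 1 ≤ j → j ≤ k → ∀ X : (Sect2.domSys (F.P K) M j).Dom, Sect2.domSites (F.P K) M j X ⊆ s.Λ j →
      ∀ a ∈ cubeIndices (F.P K) (B14.Eq213MaximalDomains.side (F.P K).L M (j + 1)),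
        (cubeEnl (F.P K) (B14.Eq213MaximalDomains.side (F.P K).L M (j + 1)) a 0 ∩ Sect2.domSites (F.P K) M j X).Nonempty →
        cubeEnl (F.P K) (B14.Eq213MaximalDomains.side (F.P K).L M (j + 1)) a 0 ⊆ s.Ω j)
    (h7 : Dat K s.Ω (Sup ν K s.Ω) k (fun n => cR * epsOfRecord ν S.flow.g n) W)
    {U₀ : GaugeField (F.P K) 0 (SU N)} (hmin : IsMinimizerB (avOfRecord F N K)
      {U | (∀ n, n ≤ k → PlaqSmallOn (Sect2.omegaPlaqsTop s.Ω (Sup ν K s.Ω) n) (ν.εreg * (F.P K).eta n ^ 2) U) ∧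
        Sect2.CoDivClassOnTop s.Ω (Sup ν K s.Ω) k ν.εreg U} (bd K k s.Ω) W U₀) :
    ∀ j, 1 ≤ j → j ≤ k → ∀ X : (Sect2.domSys (F.P K) M j).Dom,
      (Sect2.domSites (F.P K) M j X ⊆ s.Λ j →
        Sect2.ofBackgroundC S.ι (U₀) ∈
          Sect2.spaceI S (Sect2.Residual.unit (F.P K) (MatA N)) M j (Sect2.domSites (F.P K) M j X) (S.lf.alpha0 (S.flow.g j)) (S.lf.alpha1 (S.flow.g j))) ∧
      (Sect2.admB (F.P K) ν M S.flow.g s.Ω s.Λ j (Sect2.domSites (F.P K) M j X) = true →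
        Sect2.ofBackgroundC S.ι (U₀) ∈
          Sect2.spaceMS S (Sect2.Residual.unit (F.P K) (MatA N)) M j (Sect2.domSites (F.P K) M j X) s.Ω) := by
  have hplaq := plaqSmallOn_of_thm1RegSepTop7MGB h15 ν M S.flow.g K k cR s hsep hM₁ hadm hnum ha₀ hcomp hcomp' h7 hmin
  have hclass : ∀ n, 1 ≤ n → n ≤ k → PlaqSmallOn (omegaPlaqs s.Ω n) (B₃ * (cR * epsOfRecord ν S.flow.g n) * (F.P K).eta n ^ 2) U₀ := by
    intro n hn1 hnk
    have := hplaq n hnk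
    rwa [Sect2.omegaPlaqsTop_of_ne_zero _ _ (Nat.one_le_iff_ne_zero.mp hn1)] at this
  have hg := localGaugeOn_of_thm1GaugeRegSepTop7MGB h15G ν S.flow.g K k cR s hsep hM₁ hadm hnum ha₀ hcomp hcomp' h7 hmin
  exact bgRowAtDatumU_of_classBoundsPos_of_localGauge_of_hcubeΩ S hι h𝓜 hS hpos ν K k s U₀ hcube hclass hα hBα htI htMS
    (fun n hn1 hnk => (hg n hn1 hnk).1 (hsN n hn1 (by omega))) (fun n hn1 hnk => (hg n hn1 hnk).2 (hsN (n + 1) (by omega) (by omega)))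
/-- **§7.3 ★★ ROW P11's BODY AT A STAGE-13 BACKGROUND `Ubg p n s 𝐖` — `(Adm, bd, Dat)`-GENERIC, BACKGROUND-GENERIC, NO RUN GUARD, `hcubeΩ` RUN-INDEXED** — §4 with the guarded
`(bd, Dat)` sentences and the background a PARAMETER entering only through its per-prefix spec dichotomy `hbg` («`bd`-minimiser over the class of record at `𝐖`, or junk `1`»; k0-s1-w1's §3
pattern WITHOUT `PartCompat₁₃`).  Today: `Ubg := UbgMSCoPOfRecord …`, `bd := genSetDatum F`, `hbg := ubgMSCoPOfRecord_dichotomy_genSetDatum`; after the Stage-2 seam edit: `Ubg p n s := UbgOfRecord₁₃CoP F N θ p n s`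
(`UbgOfRecord₁₃CoP_succ` ↦ `UbgMSCoPOfRecordB`), `bd := lamDatum F`, `hbg := ubgMSCoPOfRecordB_dichotomy` (S2b) — §5∕§6 and the siblings re-key by one instantiation.  A REDUCTION. [cite: Balaban1985Variational, (6)–(7) p.278, Thm 1 (8)–(9) p.279, Prop. 8 p.304; Balaban1984PropagatorsII, (2.3) p.224; Balaban1988Convergent, Thm 1 p.262, (2.12)–(2.13) p.256; Balaban1987RG1, (0.1) p.251, (1.11)–(1.16) p.262] -/
theorem stage13_bgAtDatumBg_of_thm1RegSepCoP7MGB_of_thm1GaugeGB_of_hcubeΩ (θ : Stage13Params F N) (hθ : θ.Admissible F N) (hRz : θ.Rz = RzOfRecord F N)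
    {Adm : StepGuard F} {bd : BondDatum F} {Dat : TopData F N} {B₃ B₃' a₀ a₁ : ℝ}
    (h15 : VariationalThm1RegSepCoP7MGB F N Adm bd Dat B₃ a₀ a₁) (h15G : VariationalThm1GaugeRegSepCoP7MGB F N θ.τ9.M Adm bd Dat B₃ B₃' a₀ a₁)
    (Ubg : (p : B12.RunParams) → (n : ℕ) → SeqOfRecord F θ.ν θ.τ9.M (gOfRecord₁₃ F N θ p) p.K n → MSField (F.P p.K) (SU N) → GaugeField (F.P p.K) 0 (SU N))
    (hbg : ∀ (p : B12.RunParams) (n : ℕ) (s : SeqOfRecord F θ.ν θ.τ9.M (gOfRecord₁₃ F N θ p) p.K n) (W : MSField (F.P p.K) (SU N)),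
      IsMinimizerB (avOfRecord F N p.K) (regMSCoPOfRecord F N θ.ν p.K n s.Ω) (bd p.K n s.Ω) W (Ubg p n s W) ∨ Ubg p n s W = 1)
    (hnum : ∀ (p : B12.RunParams) (n : ℕ), n ≤ p.K → Step.InInterval θ.γ n (gOfRecord₁₃ F N θ p) → ∀ m, m ≤ n →
      0 < θ.s2.cR * epsOfRecord θ.ν (gOfRecord₁₃ F N θ p) m ∧ θ.s2.cR * epsOfRecord θ.ν (gOfRecord₁₃ F N θ p) m ≤ a₁ ∧ B₃ * (θ.s2.cR * epsOfRecord θ.ν (gOfRecord₁₃ F N θ p) m) ≤ θ.ν.εreg)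
    (ha₀ : θ.ν.εreg ≤ a₀)
    (hcomp : ∀ (p : B12.RunParams) (n : ℕ), n ≤ p.K → Step.InInterval θ.γ n (gOfRecord₁₃ F N θ p) → ∀ m, m < n →
      θ.s2.cR * epsOfRecord θ.ν (gOfRecord₁₃ F N θ p) m ≤ 2 * (θ.s2.cR * epsOfRecord θ.ν (gOfRecord₁₃ F N θ p) (m + 1)))
    (hcomp' : ∀ (p : B12.RunParams) (n : ℕ), n ≤ p.K → Step.InInterval θ.γ n (gOfRecord₁₃ F N θ p) → ∀ m, m < n →
      θ.s2.cR * epsOfRecord θ.ν (gOfRecord₁₃ F N θ p) (m + 1) ≤ 2 * (θ.s2.cR * epsOfRecord θ.ν (gOfRecord₁₃ F N θ p) m))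
    (hBα : ∀ (p : B12.RunParams) (n : ℕ), n ≤ p.K → Step.InInterval θ.γ n (gOfRecord₁₃ F N θ p) → ∀ m, 1 ≤ m → m ≤ n →
      B₃ * (θ.s2.cR * epsOfRecord θ.ν (gOfRecord₁₃ F N θ p) m) ≤ (1 - θ.s2.βc) * (lfOfRecord₁₂ F N θ.toStage12Params).alpha0 (gOfRecord₁₃ F N θ p m))
    (htI : ∀ (p : B12.RunParams) (n : ℕ), n ≤ p.K → Step.InInterval θ.γ n (gOfRecord₁₃ F N θ p) → ∀ m, 1 ≤ m → m ≤ n →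
      B₃' * (θ.s2.cR * epsOfRecord θ.ν (gOfRecord₁₃ F N θ p) m) ≤ θ.s2.cB * (lfOfRecord₁₂ F N θ.toStage12Params).alpha0 (gOfRecord₁₃ F N θ p m))
    (htMS : ∀ (p : B12.RunParams) (n : ℕ), n ≤ p.K → Step.InInterval θ.γ n (gOfRecord₁₃ F N θ p) → ∀ m, 1 ≤ m → m ≤ n →
      B₃' * (θ.s2.cR * epsOfRecord θ.ν (gOfRecord₁₃ F N θ p) m) ≤ θ.s2.B * θ.s2.C * θ.s2.Mr * (lfOfRecord₁₂ F N θ.toStage12Params).alpha0 (gOfRecord₁₃ F N θ p m))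
    (hcube : ∀ (p : B12.RunParams) (n : ℕ), n ≤ p.K → Step.InInterval θ.γ n (gOfRecord₁₃ F N θ p) →
      ∀ s : SeqOfRecord F θ.ν θ.τ9.M (gOfRecord₁₃ F N θ p) p.K n, ∀ j, 1 ≤ j → j ≤ n →
      ∀ X : (Sect2.domSys (F.P p.K) θ.τ9.M j).Dom, Sect2.domSites (F.P p.K) θ.τ9.M j X ⊆ s.Λ j →
      ∀ a ∈ cubeIndices (F.P p.K) (B14.Eq213MaximalDomains.side (F.P p.K).L θ.τ9.M (j + 1)),
        (cubeEnl (F.P p.K) (B14.Eq213MaximalDomains.side (F.P p.K).L θ.τ9.M (j + 1)) a 0 ∩ Sect2.domSites (F.P p.K) θ.τ9.M j X).Nonempty →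
        cubeEnl (F.P p.K) (B14.Eq213MaximalDomains.side (F.P p.K).L θ.τ9.M (j + 1)) a 0 ⊆ s.Ω j)
    (hsN : ∀ (p : B12.RunParams) (n : ℕ), n ≤ p.K → ∀ n', 1 ≤ n' → n' ≤ n + 1 →
      ((B14.Eq213MaximalDomains.side (F.P p.K).L θ.τ9.M n' : ℕ) : ℤ) < (F.P p.K).sitesPerDir 0) :
    ∀ (p : B12.RunParams) (n : ℕ), n ≤ p.K → Step.InInterval θ.γ n (gOfRecord₁₃ F N θ p) →
      ∀ s : SeqOfRecord F θ.ν θ.τ9.M (gOfRecord₁₃ F N θ p) p.K n, Sect2.SeqSeparated θ.ν.M₁ s → 0 < θ.ν.M₁ →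
      Adm θ.ν θ.τ9.M (gOfRecord₁₃ F N θ p) p.K n s → ∀ W : MSField (F.P p.K) (SU N),
      Dat p.K s.Ω (suppDomOfRecord F θ.ν p.K s.Ω) n (fun j => θ.s2.cR * epsOfRecord θ.ν (gOfRecord₁₃ F N θ p) j) W →
      ∀ j, 1 ≤ j → j ≤ n → ∀ X : (Sect2.domSys (F.P p.K) θ.τ9.M j).Dom,
      (Sect2.domSites (F.P p.K) θ.τ9.M j X ⊆ s.Λ j →
        Sect2.ofBackgroundC (settingOfRecord₁₃ F N θ p).ι (Ubg p n s W) ∈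
          Sect2.spaceI (settingOfRecord₁₃ F N θ p) (θ.Rz p.K) θ.τ9.M j (Sect2.domSites (F.P p.K) θ.τ9.M j X)
            ((settingOfRecord₁₃ F N θ p).lf.alpha0 ((settingOfRecord₁₃ F N θ p).flow.g j)) ((settingOfRecord₁₃ F N θ p).lf.alpha1 ((settingOfRecord₁₃ F N θ p).flow.g j))) ∧
      (Sect2.admB (F.P p.K) θ.ν θ.τ9.M (gOfRecord₁₃ F N θ p) s.Ω s.Λ j (Sect2.domSites (F.P p.K) θ.τ9.M j X) = true →
        Sect2.ofBackgroundC (settingOfRecord₁₃ F N θ p).ι (Ubg p n s W) ∈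
          Sect2.spaceMS (settingOfRecord₁₃ F N θ p) (θ.Rz p.K) θ.τ9.M j (Sect2.domSites (F.P p.K) θ.τ9.M j X) s.Ω) := by
  intro p n hn hw s hsep hM₁ hadm W h7
  rw [hRz]
  rcases hbg p n s W with hmin | h1
  · exact bgRowAtDatumU_of_thm1RegSepTop7MGB_of_thm1GaugeGB_of_hcubeΩ h15 h15G (settingOfRecord₁₃ F N θ p) rfl rfl (settingOfRecord₁₃_laws F N θ p)
      (settingOfRecord₁₃_pos F N θ hθ.1.pos p) θ.ν p.K n θ.s2.cR (hnum p n hn hw) ha₀ (hcomp p n hn hw) (hcomp' p n hn hw)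
      (fun m _ hm => alphaPos₁₃_of_inInterval hθ hw hm) (hBα p n hn hw) (htI p n hn hw) (htMS p n hn hw) (hsN p n hn) s hsep hM₁ hadm (hcube p n hn hw s) h7 hmin
  · rw [h1]
    exact bgRowAtDatum_one (settingOfRecord₁₃ F N θ p) (settingOfRecord₁₃_pos F N θ hθ.1.pos p) θ.ν θ.τ9.M p.K n s
      (fun m _ hm => alphaPos₁₃_of_inInterval hθ hw hm)

end Summit.QuantumFields.YangMills.Theorems.BalabanUVNodesN11BgRowGaugeROfHcubeOmega

end
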